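import Literature.Analysis.FunctionSpaces.TorusLatticeCellTranslation
import Literature.Analysis.FluidPDE.StationaryEulerLaminateWaves
import Literature.Analysis.FluidPDE.StationaryEulerTorusBlocks
import HarnessLib

/-!
# Grid packets on the flat torus: cellwise structure and the oscillation bound
(Choffrut–Székelyhidi 2014, §2 Step 3, "covering and rescaling")

Topic `Literature/Analysis/FluidPDE`. Support file of the proof of
`Literature.Analysis.FluidPDE.Torus.ChoffrutSzekelyhidi2014_thm1` (Choffrut–Székelyhidi, SIAM
J. Math. Anal. 46 (2014) = arXiv:1401.4301). The increment of one convex-integration step is a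
*grid packet*: on every cell `κ/m + m⁻¹[0,1)^d` of the fundamental cube a rescaled copy of a
reference packet `Q κ` (supported in the open unit cube) is placed, and the sum is read on
`T^d` through `Packet.tfield`. This file records the cellwise structure behind the two
"smallness by fine oscillation" statements of the scheme that do not need Fourier analysis:

* `gridPacket hm Q` and its torus field `gridField`: supported in the open cube, smooth, a weak
  subsolution, admissible, bounded by the bound of the reference packets, equal on the open cell
  `κ` to the copy `κ`, and **cellwise mean free**: `∫_{Q_κ} gridField ∘ proj = 0` for every cell;
* the **oscillation bound** `|∫ (gridField)_c f| ≤ M η` as soon as `f` oscillates by at most `η`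
  on the cells (`abs_integral_gridField_mul_le`), and the uniform-continuity lemma providing such
  an `η` for fine grids (`exists_mesh_osc_le`): increments are weakly small against fixed
  continuous functions (near-orthogonality to the previous states).

## References

* A. Choffrut, L. Székelyhidi Jr., SIAM J. Math. Anal. 46 (2014), §2, Step 3.
-/

noncomputable section

open scoped InnerProductSpace ContDiff ENNReal
open Set Function MeasureTheory Metric
open Literature.Analysis.FunctionSpaces

namespace Literature.Analysis.FluidPDE

namespace StationaryEuler

variable {d : Type*} [Fintype d] [DecidableEq d]

/-! ## Grid packets -/

/-- The integer index of a cell index `κ : d → Fin m`. [folklore] -/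
def gridIdx {m : ℕ} (κ : d → Fin m) : d → ℤ := fun i => ((κ i : ℕ) : ℤ)

omit [Fintype d] [DecidableEq d] in
/-- `gridIdx` is injective. [folklore] -/
theorem gridIdx_injective {m : ℕ} : Injective (gridIdx (d := d) (m := m)) := by
  intro κ κ' h
  funext i
  have := congrFun h i
  simp only [gridIdx, Nat.cast_inj] at this
  exact Fin.ext this

/-- The set of all cell indices of the fundamental cube. [folklore] -/
def gridSet (m : ℕ) : Finset (d → ℤ) := (Finset.univ : Finset (d → Fin m)).image gridIdx

/-- The identity frame. [folklore] -/
abbrev frame0 : Ed d ≃ₗᵢ[ℝ] Ed d := LinearIsometryEquiv.refl ℝ (Ed d)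

omit [DecidableEq d] in
/-- The reference cube of the identity frame is the open unit cube. [folklore] -/
@[simp] theorem refCube_frame0 : refCube (frame0 (d := d)) = box d := rfl

omit [DecidableEq d] in
/-- Aligned cubes of the identity frame are open lattice cells. [folklore] -/
@[simp] theorem acube_frame0 (m : ℕ) (κ : d → ℤ) : acube (frame0 (d := d)) m κ = Torus.latticeCellInterior m κ := rfl

/-- **The grid packet**: rescaled copies of the reference packets `Q κ` on all cells of mesh
`m⁻¹` of the fundamental cube. [cite: ChoffrutSzekelyhidi2014, §2, Step 3] -/
def gridPacket {m : ℕ} (hm : 0 < m) (Q : (d → ℤ) → Packet d) : Packet d := placed frame0 hm (gridSet m) Q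

omit [Fintype d] [DecidableEq d] in
/-- Open cells of the fundamental cube lie in the open unit cube. [folklore] -/
theorem latticeCellInterior_subset_box {m : ℕ} (hm : 0 < m) (κ : d → Fin m) :
    Torus.latticeCellInterior m (gridIdx κ) ⊆ box d := by
  intro y hy i
  have hm' : (0 : ℝ) < m := by exact_mod_cast hm
  obtain ⟨h1, h2⟩ := hy i
  simp only [gridIdx, Int.cast_natCast] at h1 h2
  have hk0 : (0 : ℝ) ≤ (κ i : ℕ) := Nat.cast_nonneg _
  have hk1 : ((κ i : ℕ) : ℝ) + 1 ≤ m := by exact_mod_cast (κ i).isLt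
  constructor
  · exact lt_of_le_of_lt (div_nonneg hk0 hm'.le) h1
  · exact lt_of_lt_of_le h2 ((div_le_one hm').2 hk1)

/-- Members of `gridSet` come from cell indices. [folklore] -/
theorem mem_gridSet {m : ℕ} {κ : d → ℤ} : κ ∈ gridSet (d := d) m ↔ ∃ κ' : d → Fin m, gridIdx κ' = κ := by
  simp [gridSet]

/-! ## Cells of the fundamental cube and continuous functions on the torus -/

/-- The integral over the torus as a sum over the cells of the fundamental cube. [folklore] -/
theorem integral_eq_sum_cells {m : ℕ} (hm : 0 < m) {g : UnitAddTorus d → ℝ} (hg : Continuous g) :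
    ∫ x, g x = ∑ κ : d → Fin m, ∫ y in Torus.latticeCell m (gridIdx κ), g (Torus.proj y) := by
  rw [Torus.integral_eq_integral_lift_holds g]
  simp only [show Torus.lift g = fun y => g (Torus.proj y) from funext fun y => Torus.lift_apply g y]
  exact Torus.setIntegral_unitCube_eq_sum_latticeCell hm
    (Torus.integrableOn_unitCube_of_continuous (hg.comp Torus.continuous_proj))

/-- **Fine grids make continuous functions oscillate little on cells**: for continuous `f` on
`T^d` and `η > 0` there is `m₀` such that for all `m ≥ m₀`, `f ∘ proj` oscillates by at most `η`
on every cell of mesh `m⁻¹` of the fundamental cube (uniform continuity on the compact closed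
ball containing the cube, cells have diameter `≤ √d / m`). [folklore] -/
theorem exists_mesh_osc_le {f : UnitAddTorus d → ℝ} (hf : Continuous f) {η : ℝ} (hη : 0 < η) :
    ∃ m₀ : ℕ, 0 < m₀ ∧ ∀ m : ℕ, m₀ ≤ m → ∀ κ : d → Fin m, ∀ y ∈ Torus.latticeCell m (gridIdx κ),
      ∀ y' ∈ Torus.latticeCell m (gridIdx κ), |f (Torus.proj y) - f (Torus.proj y')| ≤ η := by
  have hK : IsCompact (closedBall (0 : Ed d) (Fintype.card d)) := isCompact_closedBall _ _
  have huc := hK.uniformContinuousOn_of_continuous (hf.comp Torus.continuous_proj).continuousOn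
  obtain ⟨δ, hδ, hδu⟩ := Metric.uniformContinuousOn_iff.1 huc η hη
  obtain ⟨m₀, hm₀⟩ := exists_nat_gt (Real.sqrt (Fintype.card d) / δ)
  have hm₀pos : 0 < m₀ := by
    have : (0 : ℝ) < m₀ := lt_of_le_of_lt (div_nonneg (Real.sqrt_nonneg _) hδ.le) hm₀
    exact_mod_cast this
  refine ⟨m₀, hm₀pos, fun m hm κ y hy y' hy' => ?_⟩
  have hmpos : 0 < m := lt_of_lt_of_le hm₀pos hm
  have hm' : (0 : ℝ) < m := by exact_mod_cast hmpos
  have hyU := Torus.latticeCell_subset_unitCube hmpos κ hy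
  have hy'U := Torus.latticeCell_subset_unitCube hmpos κ hy'
  have hdist : dist y y' < δ := by
    rw [dist_eq_norm, ← neg_sub, norm_neg]
    calc ‖y' - y‖ ≤ Real.sqrt (Fintype.card d) / m := Torus.norm_sub_le_of_mem_latticeCell hmpos hy hy'
      _ ≤ Real.sqrt (Fintype.card d) / m₀ :=
          div_le_div_of_nonneg_left (Real.sqrt_nonneg _) (by exact_mod_cast hm₀pos) (by exact_mod_cast hm)
      _ < δ := by
          rw [div_lt_iff₀ (by exact_mod_cast hm₀pos : (0 : ℝ) < m₀)]
          calc Real.sqrt (Fintype.card d) = Real.sqrt (Fintype.card d) / δ * δ := by field_simp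
            _ < m₀ * δ := by gcongr
            _ = δ * m₀ := mul_comm _ _
  have h := hδu y (Torus.unitCube_subset_closedBall hyU) y' (Torus.unitCube_subset_closedBall hy'U) hdist
  rw [Real.dist_eq] at h
  exact h.le

variable {m : ℕ} (hm : 0 < m) {Q : (d → ℤ) → Packet d} (hQ : ∀ κ, Packet.SuppIn (box d) (Q κ))
include hQ

/-- The grid packet is supported in the open unit cube. [folklore] -/
theorem suppIn_gridPacket : Packet.SuppIn (box d) (gridPacket hm Q) := by
  refine (suppIn_placed frame0 hm (gridSet m) fun κ _ => hQ κ).mono (iUnion₂_subset fun κ hκ => ?_)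
  obtain ⟨κ', rfl⟩ := mem_gridSet.1 hκ
  exact latticeCellInterior_subset_box hm κ'

/-- On the open cell `κ` the grid packet's field is the copy `κ`. [folklore] -/
theorem field_gridPacket_of_mem {κ : d → Fin m} {y : Ed d} (hy : y ∈ Torus.latticeCellInterior m (gridIdx κ)) :
    Packet.field (gridPacket hm Q) y = Packet.field (Q (gridIdx κ)) ((m : ℝ) • (y - corner frame0 m (gridIdx κ))) :=
  field_placed_of_mem frame0 hm (gridSet m) (fun κ _ => hQ κ) (mem_gridSet.2 ⟨κ, rfl⟩) hy

/-- Off the open cells the grid packet's field vanishes. [folklore] -/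
theorem field_gridPacket_eq_zero {y : Ed d} (hy : ∀ κ : d → Fin m, y ∉ Torus.latticeCellInterior m (gridIdx κ)) :
    Packet.field (gridPacket hm Q) y = 0 :=
  field_placed_of_not_mem frame0 hm (gridSet m) (fun κ _ => hQ κ) fun κ hκ => by
    obtain ⟨κ', rfl⟩ := mem_gridSet.1 hκ
    exact hy κ'

/-- **Uniform bound**: the grid packet's field is bounded by any common bound of the reference
fields. [folklore] -/
theorem norm_field_gridPacket_le {M : ℝ} (hM0 : 0 ≤ M) (hM : ∀ κ y, ‖Packet.field (Q κ) y‖ ≤ M) (y : Ed d) :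
    ‖Packet.field (gridPacket hm Q) y‖ ≤ M := by
  by_cases h : ∃ κ : d → Fin m, y ∈ Torus.latticeCellInterior m (gridIdx κ)
  · obtain ⟨κ, hy⟩ := h
    rw [field_gridPacket_of_mem hm hQ hy]; exact hM _ _
  · push Not at h
    rw [field_gridPacket_eq_zero hm hQ h, norm_zero]; exact hM0

/-! ## The torus field of a grid packet -/

/-- The torus field of the grid packet. [cite: ChoffrutSzekelyhidi2014, §2, Step 3] -/
abbrev gridField (hm : 0 < m) (Q : (d → ℤ) → Packet d) : UnitAddTorus d → State d :=
  Packet.tfield (gridPacket hm Q)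

/-- The grid field is smooth. [folklore] -/
theorem isSmooth_gridField : Torus.IsSmooth (gridField hm Q) := Packet.isSmooth_tfield (suppIn_gridPacket hm hQ)

/-- The grid field is a weak subsolution. [folklore] -/
theorem isTorusSub_gridField : IsTorusSub (gridField hm Q) := Packet.isTorusSub_tfield (suppIn_gridPacket hm hQ)

/-- The grid field is admissible-valued. [folklore] -/
theorem isAdm_gridField [Nonempty d] (x : UnitAddTorus d) : IsAdm (gridField hm Q x) :=
  Packet.isAdm_tfield (suppIn_gridPacket hm hQ) x

/-- The grid field is bounded by the bound of the reference fields. [folklore] -/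
theorem norm_gridField_le {M : ℝ} (hM0 : 0 ≤ M) (hM : ∀ κ y, ‖Packet.field (Q κ) y‖ ≤ M) (x : UnitAddTorus d) :
    ‖gridField hm Q x‖ ≤ M := by
  rw [gridField, Packet.tfield_apply (suppIn_gridPacket hm hQ)]
  exact norm_field_gridPacket_le hm hQ hM0 hM _

/-- The grid field at `proj y`, `y` in the fundamental cube, is the field at `y`. [folklore] -/
theorem gridField_proj {y : Ed d} (hy : y ∈ Torus.unitCube d) :
    gridField hm Q (Torus.proj y) = Packet.field (gridPacket hm Q) y := by
  rw [gridField, Packet.tfield_apply (suppIn_gridPacket hm hQ), Torus.repr_proj_of_mem_unitCube_holds hy]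

/-- **Energy of the grid field**: `∫ ‖gridField‖² = Σ_κ m^{-d} ∫ ‖field (Q κ)‖²`. [folklore] -/
theorem integral_sq_gridField :
    ∫ x, ‖gridField hm Q x‖ ^ 2 = ∑ κ : d → Fin m, ((m : ℝ)⁻¹) ^ Fintype.card d * ∫ y, ‖Packet.field (Q (gridIdx κ)) y‖ ^ 2 := by
  have hsupp := suppIn_gridPacket hm hQ
  rw [Packet.integral_sq_tfield hsupp]
  -- the energy density vanishes off the union of the open cells
  have hint : Integrable fun y => ‖Packet.field (gridPacket hm Q) y‖ ^ 2 := integrable_sq_field _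
  have hU : ∫ y, ‖Packet.field (gridPacket hm Q) y‖ ^ 2 =
      ∫ y in ⋃ κ ∈ (Finset.univ : Finset (d → Fin m)), Torus.latticeCellInterior m (gridIdx κ),
        ‖Packet.field (gridPacket hm Q) y‖ ^ 2 := by
    refine (setIntegral_eq_integral_of_forall_compl_eq_zero fun y hy => ?_).symm
    rw [field_gridPacket_eq_zero hm hQ fun κ hκ => hy (mem_iUnion₂.2 ⟨κ, Finset.mem_univ _, hκ⟩), norm_zero]
    norm_num
  rw [hU, integral_biUnion_finset _ (fun κ _ => Torus.measurableSet_latticeCellInterior) (fun κ _ κ' _ h =>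
    (Torus.disjoint_latticeCell hm (gridIdx_injective.ne h)).mono Torus.latticeCellInterior_subset
      Torus.latticeCellInterior_subset) fun κ _ => hint.integrableOn]
  refine Finset.sum_congr rfl fun κ _ => ?_
  rw [setIntegral_congr_fun Torus.measurableSet_latticeCellInterior fun y hy => by
    rw [field_gridPacket_of_mem hm hQ hy, show Packet.field (Q (gridIdx κ)) ((m : ℝ) • (y - corner frame0 m (gridIdx κ))) =
      0 + Packet.field (Q (gridIdx κ)) ((m : ℝ) • (y - corner frame0 m (gridIdx κ))) from (zero_add _).symm]]
  have := setIntegral_sq_const_add frame0 hm (hQ (gridIdx κ)) (gridIdx κ) 0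
  rw [acube_frame0] at this
  rw [this, norm_zero]; ring

/-- **Cellwise mean zero**: on every cell of the fundamental cube the lift of the grid field
integrates to zero (each copy has integral zero and is supported inside its open cell).
[cite: ChoffrutSzekelyhidi2014, §2, Step 3] -/
theorem setIntegral_cell_gridField (κ : d → Fin m) :
    ∫ y in Torus.latticeCell m (gridIdx κ), gridField hm Q (Torus.proj y) = 0 := by
  have hsupp := suppIn_gridPacket hm hQ
  have h1 : ∫ y in Torus.latticeCell m (gridIdx κ), gridField hm Q (Torus.proj y) =
      ∫ y in Torus.latticeCell m (gridIdx κ), Packet.field (Q (gridIdx κ)) ((m : ℝ) • (y - corner frame0 m (gridIdx κ))) := by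
    refine setIntegral_congr_fun Torus.measurableSet_latticeCell fun y hy => ?_
    rw [gridField_proj hm hQ (Torus.latticeCell_subset_unitCube hm κ hy)]
    by_cases hyo : y ∈ Torus.latticeCellInterior m (gridIdx κ)
    · exact field_gridPacket_of_mem hm hQ hyo
    · rw [field_gridPacket_eq_zero hm hQ fun κ' hκ' => ?_, field_rescale_eq_zero frame0 hm (hQ _) hyo]
      by_cases hκκ : κ' = κ
      · exact hyo (hκκ ▸ hκ')
      · exact (Torus.disjoint_latticeCell hm (gridIdx_injective.ne hκκ)).ne_of_mem
          (Torus.latticeCellInterior_subset hκ') hy rfl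
  have h2 : ∫ y in Torus.latticeCell m (gridIdx κ), Packet.field (Q (gridIdx κ)) ((m : ℝ) • (y - corner frame0 m (gridIdx κ))) =
      ∫ y, Packet.field (Q (gridIdx κ)) ((m : ℝ) • (y - corner frame0 m (gridIdx κ))) := by
    refine setIntegral_eq_integral_of_forall_compl_eq_zero fun y hy => ?_
    refine field_rescale_eq_zero frame0 hm (hQ (gridIdx κ)) (κ := gridIdx κ) fun h => hy ?_
    exact Torus.latticeCellInterior_subset h
  rw [h1, h2]
  exact integral_field_rescaled (Q (gridIdx κ)) m _

/-- The lift of the grid field is integrable on every cell. [folklore] -/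
theorem integrableOn_cell_gridField (κ : d → Fin m) :
    IntegrableOn (fun y => gridField hm Q (Torus.proj y)) (Torus.latticeCell m (gridIdx κ)) volume :=
  (Torus.integrableOn_unitCube_of_continuous ((Packet.continuous_tfield (suppIn_gridPacket hm hQ)).comp
    Torus.continuous_proj)).mono_set (Torus.latticeCell_subset_unitCube hm κ)

/-- Cellwise mean zero, coordinate by coordinate. [folklore] -/
theorem setIntegral_cell_gridField_apply (κ : d → Fin m) (c : Idx d) :
    ∫ y in Torus.latticeCell m (gridIdx κ), gridField hm Q (Torus.proj y) c = 0 := by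
  have h := (PiLp.proj 2 (𝕜 := ℝ) (fun _ : Idx d => ℝ) c).integral_comp_comm (integrableOn_cell_gridField hm hQ κ)
  simp only [PiLp.proj_apply] at h
  rw [h, setIntegral_cell_gridField hm hQ κ]; rfl

/-! ## The oscillation bound -/

/-- **Oscillation bound** (near-orthogonality of fine increments to fixed continuous functions):
if `f` oscillates by at most `η` on every cell of mesh `m⁻¹` and the reference fields are bounded
by `M`, then `|∫ (gridField)_c · f| ≤ M η` for every coordinate `c`: on each cell, subtract the
value of `f` at a point of the cell and use the cellwise mean zero.
[cite: ChoffrutSzekelyhidi2014, §2, Step 3] -/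
theorem abs_integral_gridField_mul_le {M η : ℝ} (hM0 : 0 ≤ M) (hM : ∀ κ y, ‖Packet.field (Q κ) y‖ ≤ M)
    {f : UnitAddTorus d → ℝ} (hf : Continuous f)
    (hosc : ∀ κ : d → Fin m, ∀ y ∈ Torus.latticeCell m (gridIdx κ), ∀ y' ∈ Torus.latticeCell m (gridIdx κ),
      |f (Torus.proj y) - f (Torus.proj y')| ≤ η)
    (c : Idx d) : |∫ x, gridField hm Q x c * f x| ≤ M * η := by
  have hm' : (0 : ℝ) < m := by exact_mod_cast hm
  have hWc : Continuous fun x => gridField hm Q x c :=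
    (PiLp.continuous_apply 2 (fun _ : Idx d => ℝ) c).comp (Packet.continuous_tfield (suppIn_gridPacket hm hQ))
  rw [integral_eq_sum_cells hm (g := fun x => gridField hm Q x c * f x) (hWc.mul hf)]
  -- the corner of cell `κ`
  set yκ : (d → Fin m) → Ed d := fun κ => WithLp.toLp 2 fun i => ((κ i : ℕ) : ℝ) / m with hyκ
  have hyκ_mem : ∀ κ, yκ κ ∈ Torus.latticeCell m (gridIdx κ) := fun κ i => by
    simp only [hyκ, gridIdx, Int.cast_natCast, PiLp.toLp_apply]
    exact ⟨le_rfl, by rw [add_div]; linarith [one_div_pos.2 hm']⟩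
  -- bound on each cell
  have hvol : ∀ κ : d → Fin m, volume.real (Torus.latticeCell m (gridIdx κ)) = ((m : ℝ)⁻¹) ^ Fintype.card d := fun κ => by
    rw [measureReal_def, Torus.volume_latticeCell hm, ENNReal.toReal_pow, ENNReal.toReal_ofReal (inv_nonneg.2 hm'.le)]
  have hcell : ∀ κ : d → Fin m, |∫ y in Torus.latticeCell m (gridIdx κ), gridField hm Q (Torus.proj y) c * f (Torus.proj y)|
      ≤ M * η * ((m : ℝ)⁻¹) ^ Fintype.card d := fun κ => by
    have hint := integrableOn_cell_gridField hm hQ κ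
    have hintc : IntegrableOn (fun y => gridField hm Q (Torus.proj y) c) (Torus.latticeCell m (gridIdx κ)) volume :=
      (Torus.integrableOn_unitCube_of_continuous (hWc.comp Torus.continuous_proj)).mono_set
        (Torus.latticeCell_subset_unitCube hm κ)
    have hintf : IntegrableOn (fun y => gridField hm Q (Torus.proj y) c * f (Torus.proj y))
        (Torus.latticeCell m (gridIdx κ)) volume :=
      (Torus.integrableOn_unitCube_of_continuous ((hWc.mul hf).comp Torus.continuous_proj)).mono_set
        (Torus.latticeCell_subset_unitCube hm κ)
    have hsplit : (fun y => gridField hm Q (Torus.proj y) c * f (Torus.proj y)) = fun y =>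
        gridField hm Q (Torus.proj y) c * (f (Torus.proj y) - f (Torus.proj (yκ κ))) +
          f (Torus.proj (yκ κ)) * gridField hm Q (Torus.proj y) c := by
      funext y; ring
    have hint1 : IntegrableOn (fun y => gridField hm Q (Torus.proj y) c * (f (Torus.proj y) - f (Torus.proj (yκ κ))))
        (Torus.latticeCell m (gridIdx κ)) volume := by
      have : (fun y => gridField hm Q (Torus.proj y) c * (f (Torus.proj y) - f (Torus.proj (yκ κ)))) =
          fun y => gridField hm Q (Torus.proj y) c * f (Torus.proj y) - f (Torus.proj (yκ κ)) * gridField hm Q (Torus.proj y) c := by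
        funext y; ring
      rw [this]; exact hintf.sub (hintc.const_mul _)
    rw [hsplit, integral_add hint1 (hintc.const_mul _), integral_const_mul, setIntegral_cell_gridField_apply hm hQ κ c,
      mul_zero, add_zero]
    calc |∫ y in Torus.latticeCell m (gridIdx κ), gridField hm Q (Torus.proj y) c * (f (Torus.proj y) - f (Torus.proj (yκ κ)))|
        ≤ ∫ y in Torus.latticeCell m (gridIdx κ), M * η := by
          rw [← Real.norm_eq_abs]
          refine (norm_integral_le_integral_norm _).trans (setIntegral_mono_on hint1.norm
            (integrableOn_const (Torus.volume_latticeCell_ne_top hm)) Torus.measurableSet_latticeCell fun y hy => ?_)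
          rw [norm_mul, Real.norm_eq_abs, Real.norm_eq_abs]
          refine mul_le_mul ?_ (hosc κ y hy _ (hyκ_mem κ)) (abs_nonneg _) hM0
          calc |gridField hm Q (Torus.proj y) c| ≤ ‖gridField hm Q (Torus.proj y)‖ := by
                simpa using PiLp.norm_apply_le (gridField hm Q (Torus.proj y)) c
            _ ≤ M := norm_gridField_le hm hQ hM0 hM _
      _ = M * η * ((m : ℝ)⁻¹) ^ Fintype.card d := by rw [setIntegral_const, hvol, smul_eq_mul]; ring
  calc |∑ κ : d → Fin m, ∫ y in Torus.latticeCell m (gridIdx κ), gridField hm Q (Torus.proj y) c * f (Torus.proj y)|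
      ≤ ∑ κ : d → Fin m, |∫ y in Torus.latticeCell m (gridIdx κ), gridField hm Q (Torus.proj y) c * f (Torus.proj y)| :=
        Finset.abs_sum_le_sum_abs _ _
    _ ≤ ∑ _κ : d → Fin m, M * η * ((m : ℝ)⁻¹) ^ Fintype.card d := Finset.sum_le_sum fun κ _ => hcell κ
    _ = M * η := by
        rw [Finset.sum_const, Finset.card_univ, Fintype.card_fun, Fintype.card_fin, nsmul_eq_mul, Nat.cast_pow,
          inv_pow, ← mul_assoc, mul_comm ((m : ℝ) ^ Fintype.card d), mul_assoc (M * η),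
          mul_inv_cancel₀ (pow_ne_zero _ hm'.ne'), mul_one]

/-- **Inner products against fixed continuous states are small**:
`|∫ ⟪gridField, p⟫| ≤ card (Idx d) · M · η` when every coordinate of `p` oscillates by at most `η`
on the cells. [cite: ChoffrutSzekelyhidi2014, §2, Step 3] -/
theorem abs_integral_inner_gridField_le {M η : ℝ} (hM0 : 0 ≤ M) (hM : ∀ κ y, ‖Packet.field (Q κ) y‖ ≤ M)
    {p : UnitAddTorus d → State d} (hp : Continuous p)
    (hosc : ∀ c : Idx d, ∀ κ : d → Fin m, ∀ y ∈ Torus.latticeCell m (gridIdx κ), ∀ y' ∈ Torus.latticeCell m (gridIdx κ),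
      |p (Torus.proj y) c - p (Torus.proj y') c| ≤ η) :
    |∫ x, ⟪gridField hm Q x, p x⟫_ℝ| ≤ Fintype.card (Idx d) * (M * η) := by
  have hWc : ∀ c, Continuous fun x => gridField hm Q x c := fun c =>
    (PiLp.continuous_apply 2 (fun _ : Idx d => ℝ) c).comp (Packet.continuous_tfield (suppIn_gridPacket hm hQ))
  have hpc : ∀ c, Continuous fun x => p x c := fun c => (PiLp.continuous_apply 2 (fun _ : Idx d => ℝ) c).comp hp
  have hinner : (fun x => ⟪gridField hm Q x, p x⟫_ℝ) = fun x => ∑ c, gridField hm Q x c * p x c := by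
    funext x
    rw [PiLp.inner_apply]
    exact Finset.sum_congr rfl fun c _ => by simp [mul_comm]
  rw [hinner, integral_finsetSum _ fun c _ => ?_]
  · calc |∑ c, ∫ x, gridField hm Q x c * p x c| ≤ ∑ c, |∫ x, gridField hm Q x c * p x c| := Finset.abs_sum_le_sum_abs _ _
      _ ≤ ∑ _c : Idx d, M * η := Finset.sum_le_sum fun c _ => abs_integral_gridField_mul_le hm hQ hM0 hM (hpc c) (hosc c) c
      _ = Fintype.card (Idx d) * (M * η) := by rw [Finset.sum_const, Finset.card_univ, nsmul_eq_mul]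
  · exact ((hWc c).mul (hpc c)).integrable_unitAddTorus

end StationaryEuler

end Literature.Analysis.FluidPDE
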